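import Summits.CriticalPhenomena.PercolationContinuityZ3.Theorems.PercLowPointHalfSpaceTallClusterMassBoundStubBallTwoPointTransfer
import Summits.CriticalPhenomena.PercolationContinuityZ3.Theorems.PercLowPointHalfSpaceTallClusterMassBoundStubSubharmonicTransfer
import Summits.CriticalPhenomena.PercolationContinuityZ3.Theses.PercTwoPointDecay

/-!
# Line `SketchIdeator4`, crux `TallClusterMassBound` (stmt-CriticalPhenomena-0912): the open stub C⁺ in TWO-POINT route vocabulary

Companion to `Lines/SketchIdeator4_PromoteCplus.lean` (lead c1: the typical-max form `HalfBoxTypicalMaxRoute`). Lead c2 landed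
ENGINE 4 (`Theorems/PercLowPointHalfSpaceTallClusterMassBoundStubBallTwoPointTransfer.lean`, p117888): the two-sided comparison
`(M-1)²/e ≤ T(r) := Σ_{x,y ∈ Λ_r} P_{p_c}(x ↔_ℍ y) ≤ 108 r³ M` (`M = typicalMax P^ℍ_{p_c} Λ_r`), so the line's one open stub C⁺ can be
promoted in either of two vocabularies. This file writes the two-point candidates with Literature constants only (as the gate prints
route items) and proves, with no new mathematics, how each closes B and how the bulk one relates to route PercTwoPointDecay.

* `HalfBoxTwoPointSumRoute` — ℍ-native candidate: `∃ t < 11/2, ∃ C, ∀ r ≥ 1, Σ_{x,y ∈ B_r ∩ ℍ} P_{p_c}(x ↔_ℍ y) ≤ C r^t`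
  (heuristic truth `t = 2 d_f ≈ 5.05`; jump world `t = 6`; false at `p = 1`). `tallClusterMassBound_of_halfBoxTwoPointSumRoute` : it closes B.
* `CritBallAverageDecayHalfRoute` — bulk candidate: `∃ a C, 1/2 < a ∧ ∀ R ≥ 1, Σ_{z ∈ B_R} τ_{p_c}(0,z) ≤ C R^{3-a}` (truth `a = 1 + η ≈ 0.95`).
  `tallClusterMassBound_of_critBallAverageDecayHalfRoute` : it closes B; `critBallAverageDecay_of_half` : it implies VERBATIM the target
  `CritBallAverageDecay` of route PercTwoPointDecay (stmt-CriticalPhenomena-0833, `a > 0`), i.e. it is a SHARED strengthening of that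
  route's target — and, like it, summit-closing by itself (`τ ≥ θ²`), so as an item it would be a costume-with-a-rate; recorded for the
  planner's choice, not recommended over the ℍ-native forms.
* (lead c2, second landing p118651, `Theorems/…StubSubharmonicTransfer.lean`) **the EXISTING-ITEM route**: `TallClusterMassBoundAllRoute`
  := "`∀ m > 11/4, ∃ C, ∀ r ≥ 1, E[|C_ℍ(0) ∩ B_r| ; arm_ℍ(0,r)] ≤ C r^m π_s(r)`" (B with `11/4` replaced by every `m > 11/4`; B ⟹ it by
  monotonicity, `tallClusterMassBoundAllRoute_of_tallClusterMassBound`), and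
  `tallClusterMassBoundAllRoute_of_squareSubharmonic` : **it follows from `PercSubharmonicSquare.SquareSubharmonic` (stmt-CriticalPhenomena-11506)
  VERBATIM** (`massBoundAt_of_squareSubharmonic`). Since crux A supplies `a₂ = 5/2 + κ` with SOME `κ > 0` and the bookkeeping K needs only
  `2m − 3 < a₂`, i.e. `m < 11/4 + κ/2`, the `∀ m > 11/4` form serves the route exactly as B does: restating B this way (planner `set-signature`)
  closes it MODULO the existing crux stmt-11506 with no new item and no further Lean work; keeping `m = 11/4` needs in addition the removal of
  one `log r` (ARROW 1's conditioning cost) or `SubharmonicPower` at a fixed `s < 2` (`tallClusterMassBound_of_subharmonicPower_lt_two`, landed).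
* `tallClusterMassBound_of_critPointwiseDecayHalfRoute` : B from route PercTwoPointDecay's crux `CritPointwiseDecay` (stmt-0836) at level `a > 1/2`
  (pointwise form of the dictionary; ball sums + ENGINE 4).
-/

noncomputable section

open MeasureTheory Finset
open Literature.Probability.Percolation Literature.Probability.LatticeModels
open Summit.CriticalPhenomena.PercolationContinuityZ3.Theses.PercLowPointHalfSpace (TallClusterMassBound)
open Summit.CriticalPhenomena.PercolationContinuityZ3.Theorems.TallClusterMassBound.Negative
open Summit.CriticalPhenomena.PercolationContinuityZ3.Theorems.TallClusterMassBound.TightnessLine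

namespace Summit.CriticalPhenomena.PercolationContinuityZ3.Cruxes.TallClusterMassBound.TightnessLine.Promote

/-- **C⁺ in two-point form as a route item (candidate signature, ℍ-native).** At `p_c(ℤ³)`, the half-space-restricted two-point
function summed over the half-box `Λ_r = B_r ∩ ℍ` in both variables grows with some exponent `t < 11/2`:
`∃ t < 11/2, ∃ C, ∀ r ≥ 1, Σ_{x ∈ Λ_r} Σ_{y ∈ Λ_r} P_{p_c}(x ↔_ℍ y) ≤ C r^t`. [folklore] -/
def HalfBoxTwoPointSumRoute : Prop :=
  ∃ t : ℝ, t < (11 : ℝ) / 2 ∧ ∃ C : ℝ, ∀ r : ℕ, 1 ≤ r →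
    ∑ x ∈ (Literature.Probability.LatticeModels.box 3 r).filter
        (fun x : Literature.Probability.LatticeModels.Site 3 => 0 ≤ x 0),
      ∑ y ∈ (Literature.Probability.LatticeModels.box 3 r).filter
          (fun x : Literature.Probability.LatticeModels.Site 3 => 0 ≤ x 0),
        (Literature.Probability.Percolation.bondPercolation (Literature.Probability.LatticeModels.zdGraph 3)
            (Literature.Probability.Percolation.criticalProbI 3)).real
          (Literature.Probability.Percolation.openConnIn
            {x : Literature.Probability.LatticeModels.Site 3 | 0 ≤ x 0} x y) ≤
      C * (r : ℝ) ^ t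

/-- The ℍ-native candidate is DEFINITIONALLY the hypothesis of the landed glue `tallClusterMassBound_of_halfBoxTwoPointSum`
(`halfBox r = (box 3 r).filter (0 ≤ · 0)`, `Pp p = bondPercolation (zdGraph 3) p`, `Hs = {x | 0 ≤ x 0}`). [folklore] -/
theorem halfBoxTwoPointSumRoute_iff :
    HalfBoxTwoPointSumRoute ↔
      (∃ t : ℝ, t < (11 : ℝ) / 2 ∧ ∃ C : ℝ, ∀ r : ℕ, 1 ≤ r →
        ∑ x ∈ halfBox r, ∑ y ∈ halfBox r, (Pp (criticalProbI 3)).real (openConnIn Hs x y) ≤ C * (r : ℝ) ^ t) :=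
  Iff.rfl

/-- Promoting the ℍ-native two-point form closes B modulo the new item (landed glue, p117888). [folklore] -/
theorem tallClusterMassBound_of_halfBoxTwoPointSumRoute (h : HalfBoxTwoPointSumRoute) : TallClusterMassBound := by
  obtain ⟨t, ht, C, hC⟩ := halfBoxTwoPointSumRoute_iff.1 h
  exact tallClusterMassBound_of_halfBoxTwoPointSum ht hC

/-- **The bulk candidate: ball-summed critical two-point decay at a rate `a > 1/2`** (the body of route PercTwoPointDecay's target
`CritBallAverageDecay`, stmt-CriticalPhenomena-0833, with `0 < a` strengthened to `1/2 < a`). [folklore] -/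
def CritBallAverageDecayHalfRoute : Prop :=
  ∃ a C : ℝ, (1 : ℝ) / 2 < a ∧ ∀ R : ℕ, 1 ≤ R →
    ∑ x ∈ Literature.Probability.LatticeModels.box 3 R,
      (Literature.Probability.Percolation.bondPercolation (Literature.Probability.LatticeModels.zdGraph 3)
          (Literature.Probability.Percolation.criticalProbI 3)).real
        (Literature.Probability.Percolation.openConn 0 x) ≤ C * (R : ℝ) ^ (3 - a)

/-- Promoting the bulk form closes B modulo the new item (landed glue `tallClusterMassBound_of_ballTwoPointDecay`, p117888). [folklore] -/
theorem tallClusterMassBound_of_critBallAverageDecayHalfRoute (h : CritBallAverageDecayHalfRoute) : TallClusterMassBound := by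
  obtain ⟨a, C, ha, hS⟩ := h
  exact tallClusterMassBound_of_ballTwoPointDecay ha hS

/-- The bulk form implies VERBATIM route PercTwoPointDecay's target `CritBallAverageDecay` (stmt-CriticalPhenomena-0833: `∃ a > 0, …`):
it is a shared strengthening of that target. [folklore] -/
theorem critBallAverageDecay_of_half (h : CritBallAverageDecayHalfRoute) :
    Summit.CriticalPhenomena.PercolationContinuityZ3.Theses.PercTwoPointDecay.CritBallAverageDecay := by
  obtain ⟨a, C, ha, hS⟩ := h
  exact ⟨a, C, by linarith, hS⟩

/-- **B with the exponent relaxed to every `m > 11/4` (candidate RESTATEMENT of the crux, route vocabulary).** [folklore] -/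
def TallClusterMassBoundAllRoute : Prop :=
  ∀ m : ℝ, (11 : ℝ) / 4 < m → ∃ C : ℝ, ∀ r : ℕ, 1 ≤ r →
    ∑ x ∈ Literature.Probability.LatticeModels.box 3 r,
        (Literature.Probability.Percolation.bondPercolation (Literature.Probability.LatticeModels.zdGraph 3)
            (Literature.Probability.Percolation.criticalProbI 3)).real
          (Literature.Probability.Percolation.openConnIn {x : Literature.Probability.LatticeModels.Site 3 | 0 ≤ x 0} 0 x ∩
            {ω | ∃ y : Literature.Probability.LatticeModels.Site 3, (∃ i : Fin 3, (r : ℤ) ≤ |y i|) ∧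
              ω ∈ Literature.Probability.Percolation.openConnIn {x : Literature.Probability.LatticeModels.Site 3 | 0 ≤ x 0} 0 y}) ≤
      C * (r : ℝ) ^ m *
        (Literature.Probability.Percolation.bondPercolation (Literature.Probability.LatticeModels.zdGraph 3)
            (Literature.Probability.Percolation.criticalProbI 3)).real
          {ω | ∃ y : Literature.Probability.LatticeModels.Site 3, (∃ i : Fin 3, (r : ℤ) ≤ |y i|) ∧
            ω ∈ Literature.Probability.Percolation.openConnIn {x : Literature.Probability.LatticeModels.Site 3 | 0 ≤ x 0} 0 y}

/-- The relaxed form is DEFINITIONALLY `∀ m > 11/4, MassBoundAt p_c m`. [folklore] -/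
theorem tallClusterMassBoundAllRoute_iff :
    TallClusterMassBoundAllRoute ↔ ∀ m : ℝ, (11 : ℝ) / 4 < m → MassBoundAt (criticalProbI 3) m :=
  Iff.rfl

/-- B implies its relaxed form (monotonicity of `s ↦ MassBoundAt p s`). [folklore] -/
theorem tallClusterMassBoundAllRoute_of_tallClusterMassBound (h : TallClusterMassBound) : TallClusterMassBoundAllRoute :=
  tallClusterMassBoundAllRoute_iff.2 fun _ hm => massBoundAt_mono hm.le (tallClusterMassBound_iff.1 h)

/-- **The relaxed form of B follows from the EXISTING crux `SquareSubharmonic` (stmt-CriticalPhenomena-11506) verbatim**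
(landed `massBoundAt_of_squareSubharmonic`, p118651). [folklore] -/
theorem tallClusterMassBoundAllRoute_of_squareSubharmonic
    (h : Summit.CriticalPhenomena.PercolationContinuityZ3.Theses.PercSubharmonicSquare.SquareSubharmonic) :
    TallClusterMassBoundAllRoute :=
  tallClusterMassBoundAllRoute_iff.2 (massBoundAt_of_squareSubharmonic h)

/-- **B itself from `SubharmonicPower` at any fixed exponent `s < 2`** (route vocabulary of PercSubharmonicSquare's K1 with `s` pinned
below `2`; landed `tallClusterMassBound_of_subharmonicPower_lt_two`, p118651). [folklore] -/
theorem tallClusterMassBound_of_subharmonicPowerRoute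
    (h : ∃ (s : ℝ) (R : ℕ), 0 < s ∧ s < 2 ∧ ∀ p : unitInterval,
      (p : ℝ) < Literature.Probability.Percolation.criticalProb (Literature.Probability.LatticeModels.zdGraph 3)
        (0 : Literature.Probability.LatticeModels.Site 3) →
      ∀ x : Literature.Probability.LatticeModels.Site 3, (R : ℝ) < ‖x‖ →
        Literature.Probability.Percolation.tau 3 p 0 x ^ s ≤
          (1 / 6 : ℝ) * ∑ i : Fin 3, (Literature.Probability.Percolation.tau 3 p 0 (x + Pi.single i 1) ^ s +
            Literature.Probability.Percolation.tau 3 p 0 (x - Pi.single i 1) ^ s)) :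
    TallClusterMassBound := by
  obtain ⟨s, R, hs, hs2, hsub⟩ := h
  exact tallClusterMassBound_of_subharmonicPower_lt_two hs hs2 hsub

/-- **B from POINTWISE critical two-point decay at any rate `a > 1/2`** (route PercTwoPointDecay's crux `CritPointwiseDecay`, stmt-0836, has
`∃ a > 0`; here `a > 1/2`): weaken to `min a 1`, ball sums (`ballSum_le_of_pointwise`, p118651), ENGINE 4 (p117888). [folklore] -/
theorem tallClusterMassBound_of_critPointwiseDecayHalfRoute
    (h : ∃ a C : ℝ, (1 : ℝ) / 2 < a ∧ ∀ x : Literature.Probability.LatticeModels.Site 3, x ≠ 0 →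
      (Literature.Probability.Percolation.bondPercolation (Literature.Probability.LatticeModels.zdGraph 3)
          (Literature.Probability.Percolation.criticalProbI 3)).real (Literature.Probability.Percolation.openConn 0 x) ≤
        C * ‖x‖ ^ (-a)) :
    TallClusterMassBound := by
  obtain ⟨a, C, ha, hpt⟩ := h
  set b : ℝ := min a 1 with hb
  have hb1 : b ≤ 1 := min_le_right _ _
  have hba : b ≤ a := min_le_left _ _
  have hbhalf : (1 : ℝ) / 2 < b := lt_min ha (by norm_num)
  -- `C ≥ 0` may be assumed (the bound at `x = e₀` forces `0 ≤ C` anyway); use `max C 0`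
  have hpt' : ∀ x : Literature.Probability.LatticeModels.Site 3, x ≠ 0 →
      tau 3 (criticalProbI 3) 0 x ≤ max C 0 * ‖x‖ ^ (-b) := by
    intro x hx
    have h1 : (1 : ℝ) ≤ ‖x‖ := by
      rw [Site.norm_eq_supNorm]
      have : Site.supNorm x ≠ 0 := fun h0 => hx (Site.supNorm_eq_zero_iff.1 h0)
      exact_mod_cast Nat.one_le_iff_ne_zero.2 this
    have hxa : 0 ≤ ‖x‖ ^ (-a) := Real.rpow_nonneg (by linarith) _
    calc tau 3 (criticalProbI 3) 0 x ≤ C * ‖x‖ ^ (-a) := by rw [tau_def]; exact hpt x hx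
      _ ≤ max C 0 * ‖x‖ ^ (-a) := mul_le_mul_of_nonneg_right (le_max_left _ _) hxa
      _ ≤ max C 0 * ‖x‖ ^ (-b) :=
          mul_le_mul_of_nonneg_left (Real.rpow_le_rpow_of_exponent_le h1 (by linarith)) (le_max_right _ _)
  have hball := ballSum_le_of_pointwise hb1 (le_max_right C 0) hpt'
  exact tallClusterMassBound_of_ballTwoPointDecay hbhalf hball

end Summit.CriticalPhenomena.PercolationContinuityZ3.Cruxes.TallClusterMassBound.TightnessLine.Promote
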